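import Mathlib
import Literature.Analysis.FluidPDE.HardSphereCollisionRecord
import Literature.Analysis.FluidPDE.HardSphereTorusMeasure
import Literature.MathematicalPhysics.KineticTheory.HardSphereEuler
import Literature.MathematicalPhysics.KineticTheory.HardSphereEulerProofs
import Summits.AtomisticToContinuum.HydrodynamicLimit.Theorems.OneFlightGossipEngineOneFlightLayeredChaosFirstFlightGhostInput
import Summits.AtomisticToContinuum.HydrodynamicLimit.Theorems.OneFlightGossipEngineOneFlightLayeredChaosEntranceLawTorus
import Literature.Analysis.FluidPDE.HardSphereTranslation
import Summits.AtomisticToContinuum.HydrodynamicLimit.Theorems.OneFlightGossipEngineOneFlightLayeredChaosPosGibbsTranslation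
import Summits.AtomisticToContinuum.HydrodynamicLimit.Theorems.OneFlightGossipEngineOneFlightLayeredChaosFirstFlightGhostTransfer
import Summits.AtomisticToContinuum.HydrodynamicLimit.Theorems.OneFlightGossipEngineOneFlightLayeredChaosTwoDirectionInput
import Summits.AtomisticToContinuum.HydrodynamicLimit.Theorems.OneFlightGossipEngineOneFlightLayeredChaosEntranceTimeMeasurable
import Summits.AtomisticToContinuum.HydrodynamicLimit.Theorems.OneFlightGossipEngineOneFlightLayeredChaosGhostAvoidMeasurable
import Summits.AtomisticToContinuum.HydrodynamicLimit.Theorems.OneFlightGossipEngineOneFlightLayeredChaosContactInversion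
import Summits.AtomisticToContinuum.HydrodynamicLimit.Theorems.OneFlightGossipEngineOneFlightLayeredChaosUniformMarginalAE
import HarnessLib
import Summits.AtomisticToContinuum.HydrodynamicLimit.Theorems.OneFlightGossipEngineOneFlightLayeredChaosTwoDirectionEntrance

/-!
# `OneFlightGossipEngine.OneFlightLayeredChaos` — the first rung in contact coordinates, II: the fibre formula
(crux stmt-AtomisticToContinuum-14535, line `Sketch`, lead cycle c4; part 2 of the transfer
`OLC.TwoDirectionGhostInput θ₀ → OLC.FirstFlightGhostInput θ₀`, crux notes §G2; registered carrier stub `posPartition_one_eq`).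

* `preimage_contactConfig_firstFlightGhostEvent` — in contact coordinates the first-flight ghost event of the pair (contact normal
  in `U`, cells in `T`), cut by the non-overlap set, IS the two-tube avoidance event `OLC.twoTubeEvent` cut by the cell event of
  `OLC.contactCells` — if `ω ∈ U`, and is empty otherwise (`freeEntranceTime_contact_eq`, p142041: the entrance time of the
  contact configuration is `t`, its contact normal is `ω`);
* `measurableSet_firstFlightGhostEvent` — the ghost event is measurable on the whole configuration space
  (`measurable_freeEntranceTime` p142193, `measurableSet_ghostAvoid` p142322);
* `posGibbs_firstFlightGhost_eq` — THE FIBRE FORMULA: the hard-core-uniform measure of the first-rung event equals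
  `Z⁻¹ ∫_{S²} ∫_{(0,w]} 𝟙_U(ω) · vol (E_t^ω ∩ G_T^{t,ω}) · ε² (−⟪ω, g⟫)₊ dt dσ(ω)` (`volume_inter_freeEntranceTime_mem_Ioc_eq`,
  part I, and `posGibbsMeasure_one_apply`: the hard-core-uniform law is `Z⁻¹ vol (posDomain ∩ ·)`).
-/

open scoped BigOperators ENNReal Topology
open MeasureTheory Set Filter
open Literature.Analysis.FluidPDE Literature.MathematicalPhysics.KineticTheory
open Literature.Analysis.FunctionSpaces

namespace Summit.AtomisticToContinuum.HydrodynamicLimit.Theorems.OLC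

noncomputable section

/-! ## The first-flight event in contact coordinates (set identity) -/

section SetIdentity

variable {σ : ℝ} {N : ℕ}

/-- The contact configuration is the explicit coordinate update of `freeEntranceTime_contact_eq`. [folklore] -/
theorem contactConfig_eq_update {n : ℕ} (ε : ℝ) (x : Fin n → T3) (v : Fin n → V3) (i j : Fin n) (t : ℝ) (ω : V3) :
    contactConfig ε x v i j t ω =
      Function.update x i (x j + Literature.Analysis.FunctionSpaces.Torus.proj (ε • ω - t • (v i - v j))) := rfl

/-- **The first-flight ghost event read in contact coordinates.** On a velocity fibre `v` with `g = v_i − v_j ≠ 0`,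
for a contact time `t ∈ (0, w]` with `‖g‖ t ≤ 1/4`, a unit incoming normal `ω` and `0 < ε < 1/4`: the pre-image under
`x ↦ contactConfig ε x v i j t ω` of the event "`zip (x, v)` lies in the first-flight ghost event, its contact normal lies
in `U` and its cells lie in `T`", intersected with the non-overlap set, is the two-tube avoidance event at `(t, ω)` cut by
the cell event — if `ω ∈ U` — and empty otherwise (`freeEntranceTime_contact_eq`: the entrance time of the contact
configuration is `t` and its contact normal is `ω`). [folklore] -/
theorem preimage_contactConfig_firstFlightGhostEvent
    (Ψ : HardSphereFlow (Torus.geometry (Fin 3)) (hsDiameter σ N) (N - 1)) {i j : Fin (N + 1)} (hij : j ≠ i)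
    (emb : Fin (N - 1) ↪ Fin (N + 1)) (v : Fin (N + 1) → V3) (hε : 0 < hsDiameter σ N)
    (hε4 : hsDiameter σ N < 4⁻¹) (hg : v i ≠ v j) {w t : ℝ} (ht : t ∈ Set.Ioc 0 w)
    (hgt : ‖v i - v j‖ * t ≤ 4⁻¹) {ω : V3} (hω : ‖ω‖ = 1) (hωg : inner ℝ ω (v i - v j) ≤ 0) (U : Set V3)
    (q : T3 → (Fin 3 → ℤ)) (T : Set (Fin (N + 1) → (Fin 3 → ℤ))) :
    (fun x => contactConfig (hsDiameter σ N) x v i j t ω) ⁻¹'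
        ({x | zipConfig (x, v) ∈ firstFlightGhostEvent Ψ i j emb w ∧
            (hsDiameter σ N)⁻¹ • (Torus.geometry (Fin 3)).sepVec
                (freeFlight (Torus.geometry (Fin 3)) (freeEntranceTime (hsDiameter σ N) (zipConfig (x, v)) i j)
                  (zipConfig (x, v)) i).1
                (freeFlight (Torus.geometry (Fin 3)) (freeEntranceTime (hsDiameter σ N) (zipConfig (x, v)) i j)
                  (zipConfig (x, v)) j).1 ∈ U ∧
            (fun k => q (x k)) ∈ T} ∩ posDomain (hsDiameter σ N) (N + 1)) =
      {_x | ω ∈ U} ∩ (twoTubeEvent Ψ i j emb v t ω ∩ {x | contactCells q (hsDiameter σ N) v i j t ω x ∈ T}) := by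
  ext x
  obtain ⟨htE, hsep, -⟩ := freeEntranceTime_contact_eq hε hε4 x v hij hg ht.1 hgt hω hωg
  rw [← contactConfig_eq_update] at htE hsep
  have hsmul : (hsDiameter σ N)⁻¹ • (hsDiameter σ N • ω) = ω := by
    rw [smul_smul, inv_mul_cancel₀ hε.ne', one_smul]
  have hcells : (fun k => q (contactConfig (hsDiameter σ N) x v i j t ω k)) =
      contactCells q (hsDiameter σ N) v i j t ω x := rfl
  simp only [Set.mem_preimage, Set.mem_inter_iff, Set.mem_setOf_eq, firstFlightGhostEvent, twoTubeEvent, htE, hsep,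
    hsmul, hcells, ht, true_and]
  tauto

end SetIdentity


/-! ## The first rung on a velocity fibre: the formula in contact coordinates -/

section FibreFormula

variable {σ : ℝ} {N : ℕ}

/-- The hard-core-uniform position law of an event: `Z⁻¹ · vol (posDomain ∩ B)`. [folklore] -/
theorem posGibbsMeasure_one_apply (ε : ℝ) (n : ℕ) {B : Set (Fin n → T3)} (hB : MeasurableSet B) :
    posGibbsMeasure (fun _ => (1 : ℝ)) ε n B =
      ENNReal.ofReal (posPartition (fun _ => (1 : ℝ)) ε n)⁻¹ * volume (posDomain ε n ∩ B) := by
  rw [posGibbsMeasure, withDensity_apply _ hB]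
  have hdens : (fun x : Fin n → T3 =>
      ENNReal.ofReal ((posPartition (fun _ => (1 : ℝ)) ε n)⁻¹ * posWeight (fun _ => (1 : ℝ)) ε n x)) =
      (posDomain ε n).indicator (fun _ => ENNReal.ofReal (posPartition (fun _ => (1 : ℝ)) ε n)⁻¹) := by
    funext x
    by_cases hx : x ∈ posDomain ε n
    · simp only [posWeight, Finset.prod_const_one, Set.indicator_of_mem hx, mul_one]
    · simp only [posWeight, Set.indicator_of_notMem hx, mul_zero, ENNReal.ofReal_zero]
  rw [hdens, lintegral_indicator_const (measurableSet_posDomain ε n),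
    Measure.restrict_apply (measurableSet_posDomain ε n)]

/-- The configurational partition function at activity `1` is the volume of the non-overlap set (registered carrier
lemma of this file). [folklore] -/
theorem posPartition_one_eq : ∀ (ε : ℝ) (n : ℕ), Literature.MathematicalPhysics.KineticTheory.posPartition (fun _ => (1 : ℝ)) ε n = (MeasureTheory.volume (Literature.MathematicalPhysics.KineticTheory.posDomain ε n)).toReal := by
  intro ε n
  rw [posPartition]
  have h : (fun x : Fin n → T3 => posWeight (fun _ => (1 : ℝ)) ε n x) = (posDomain ε n).indicator 1 := by
    funext x
    simp only [posWeight, Finset.prod_const_one]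
    rfl
  rw [h, integral_indicator_one (measurableSet_posDomain ε n)]
  rfl

/-- **The first-flight ghost event is measurable** (on the whole configuration space: entrance time measurable,
`measurable_freeEntranceTime`, and the ghost avoidance event measurable jointly in the horizon,
`measurableSet_ghostAvoid`). [folklore] -/
theorem measurableSet_firstFlightGhostEvent (Ψ : HardSphereFlow (Torus.geometry (Fin 3)) (hsDiameter σ N) (N - 1))
    (i j : Fin (N + 1)) (emb : Fin (N - 1) ↪ Fin (N + 1)) (w : ℝ) :
    MeasurableSet (firstFlightGhostEvent Ψ i j emb w) := by
  have h1 := measurableSet_ghostAvoid Ψ i j emb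
  have h2 : Measurable fun z : Config (N + 1) (Fin 3) T3 => (freeEntranceTime (hsDiameter σ N) z i j, z) :=
    (measurable_freeEntranceTime (hsDiameter σ N) i j).prodMk measurable_id
  have heq : firstFlightGhostEvent Ψ i j emb w =
      {z | freeEntranceTime (hsDiameter σ N) z i j ∈ Set.Ioc 0 w} ∩
        (fun z : Config (N + 1) (Fin 3) T3 => (freeEntranceTime (hsDiameter σ N) z i j, z)) ⁻¹'
          {p : ℝ × Config (N + 1) (Fin 3) T3 | (p.2 ∘ emb : Config (N - 1) (Fin 3) T3) ∈ Ψ.good ∧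
            ∀ u ∈ Set.Ioc 0 p.1, ∀ k : Fin (N - 1),
              hsDiameter σ N < ‖(Torus.geometry (Fin 3)).sepVec (Ψ.flow u (p.2 ∘ emb) k).1
                (freeFlight (Torus.geometry (Fin 3)) u p.2 i).1‖ ∧
              hsDiameter σ N < ‖(Torus.geometry (Fin 3)).sepVec (Ψ.flow u (p.2 ∘ emb) k).1
                (freeFlight (Torus.geometry (Fin 3)) u p.2 j).1‖} := by
    ext z
    simp only [firstFlightGhostEvent, Set.mem_setOf_eq, Set.mem_inter_iff, Set.mem_preimage]
    tauto
  rw [heq]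
  exact ((measurable_freeEntranceTime (hsDiameter σ N) i j) measurableSet_Ioc).inter (h2 h1)

/-- The entrance time of the zipped datum is measurable in the positions. [folklore] -/
theorem measurable_freeEntranceTime_zip (ε : ℝ) (v : Fin (N + 1) → V3) (i j : Fin (N + 1)) :
    Measurable fun x : Fin (N + 1) → T3 => freeEntranceTime ε (zipConfig (x, v)) i j :=
  (measurable_freeEntranceTime ε i j).comp (measurable_zipConfig.comp (measurable_id.prodMk measurable_const))

/-- The contact normal of the two free flights is measurable in the positions. [folklore] -/
theorem measurable_contactNormal (ε : ℝ) (v : Fin (N + 1) → V3) (i j : Fin (N + 1)) :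
    Measurable fun x : Fin (N + 1) → T3 =>
      ε⁻¹ • (Torus.geometry (Fin 3)).sepVec
        (freeFlight (Torus.geometry (Fin 3)) (freeEntranceTime ε (zipConfig (x, v)) i j) (zipConfig (x, v)) i).1
        (freeFlight (Torus.geometry (Fin 3)) (freeEntranceTime ε (zipConfig (x, v)) i j) (zipConfig (x, v)) j).1 := by
  have h : (fun x : Fin (N + 1) → T3 =>
      ε⁻¹ • (Torus.geometry (Fin 3)).sepVec
        (freeFlight (Torus.geometry (Fin 3)) (freeEntranceTime ε (zipConfig (x, v)) i j) (zipConfig (x, v)) i).1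
        (freeFlight (Torus.geometry (Fin 3)) (freeEntranceTime ε (zipConfig (x, v)) i j) (zipConfig (x, v)) j).1) =
      fun x => ε⁻¹ • Torus.reprSym ((x i - x j) +
        Literature.Analysis.FunctionSpaces.Torus.proj (freeEntranceTime ε (zipConfig (x, v)) i j • (v i - v j))) := by
    funext x
    rw [sepVec_freeFlight_eq]
    simp only [zipConfig_apply]
  rw [h]
  refine ((Torus.measurable_reprSym (d := Fin 3)).comp ?_).const_smul (ε⁻¹)
  exact ((measurable_pi_apply i).sub (measurable_pi_apply j)).add
    (Torus.measurable_proj.comp ((measurable_freeEntranceTime_zip ε v i j).smul_const (v i - v j)))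

/-- **The first rung on a velocity fibre, in contact coordinates** (crux notes §G2). With all velocities `v` frozen,
`g = v_i − v_j ≠ 0`, no wrap-around (`0 < ε < 1/4`, `‖g‖ w ≤ 1/4`): the hard-core-uniform measure of the event
"first-flight ghost event, contact normal in `U`, cells in `T`" equals `Z⁻¹` times the integral over the contact data
`(ω, t)` of `𝟙_U(ω)` times the volume of the two-tube avoidance event at `(t, ω)` cut by the cell event, against the
entrance law `ε² (−⟪ω, g⟫)₊ dt dσ(ω)`. [folklore] -/
theorem posGibbs_firstFlightGhost_eq (Ψ : HardSphereFlow (Torus.geometry (Fin 3)) (hsDiameter σ N) (N - 1))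
    {i j : Fin (N + 1)} (hij : j ≠ i) (emb : Fin (N - 1) ↪ Fin (N + 1)) (v : Fin (N + 1) → V3)
    (hε : 0 < hsDiameter σ N) (hε4 : hsDiameter σ N < 4⁻¹) (hg : v i ≠ v j) {w : ℝ} (hw : 0 < w)
    (hgw : ‖v i - v j‖ * w ≤ 4⁻¹) {U : Set V3} (hU : MeasurableSet U) {q : T3 → (Fin 3 → ℤ)} (hq : Measurable q)
    {T : Set (Fin (N + 1) → (Fin 3 → ℤ))} (hT : MeasurableSet T) :
    posGibbsMeasure (fun _ => (1 : ℝ)) (hsDiameter σ N) (N + 1)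
        {x | zipConfig (x, v) ∈ firstFlightGhostEvent Ψ i j emb w ∧
            (hsDiameter σ N)⁻¹ • (Torus.geometry (Fin 3)).sepVec
                (freeFlight (Torus.geometry (Fin 3)) (freeEntranceTime (hsDiameter σ N) (zipConfig (x, v)) i j)
                  (zipConfig (x, v)) i).1
                (freeFlight (Torus.geometry (Fin 3)) (freeEntranceTime (hsDiameter σ N) (zipConfig (x, v)) i j)
                  (zipConfig (x, v)) j).1 ∈ U ∧
            (fun k => q (x k)) ∈ T} =
      ENNReal.ofReal (posPartition (fun _ => (1 : ℝ)) (hsDiameter σ N) (N + 1))⁻¹ *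
        ∫⁻ ω : Metric.sphere (0 : V3) 1, (∫⁻ t in Set.Ioc 0 w,
          U.indicator (fun _ => volume (twoTubeEvent Ψ i j emb v t ω ∩
            {x | contactCells q (hsDiameter σ N) v i j t ω x ∈ T})) (ω : V3) *
          ENNReal.ofReal (hsDiameter σ N ^ 2 * max (-inner ℝ (ω : V3) (v i - v j)) 0)) ∂sphereMeasure := by
  have hg' : v i - v j ≠ 0 := sub_ne_zero.2 hg
  -- measurability of the event
  have hSm : MeasurableSet {x : Fin (N + 1) → T3 | zipConfig (x, v) ∈ firstFlightGhostEvent Ψ i j emb w ∧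
      (hsDiameter σ N)⁻¹ • (Torus.geometry (Fin 3)).sepVec
        (freeFlight (Torus.geometry (Fin 3)) (freeEntranceTime (hsDiameter σ N) (zipConfig (x, v)) i j) (zipConfig (x, v)) i).1
        (freeFlight (Torus.geometry (Fin 3)) (freeEntranceTime (hsDiameter σ N) (zipConfig (x, v)) i j) (zipConfig (x, v)) j).1 ∈ U ∧
      (fun k => q (x k)) ∈ T} := by
    refine ((measurableSet_firstFlightGhostEvent Ψ i j emb w).preimage
      (measurable_zipConfig.comp (measurable_id.prodMk measurable_const))).inter
      (((measurable_contactNormal (hsDiameter σ N) v i j) hU).inter ?_)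
    exact (measurable_pi_iff.mpr fun k => hq.comp (measurable_pi_apply k)) hT
  rw [posGibbsMeasure_one_apply _ _ hSm]
  congr 1
  -- the event lies in `{t⋆ ∈ (0, w]}`
  have hsub : posDomain (hsDiameter σ N) (N + 1) ∩ {x : Fin (N + 1) → T3 | zipConfig (x, v) ∈ firstFlightGhostEvent Ψ i j emb w ∧
      (hsDiameter σ N)⁻¹ • (Torus.geometry (Fin 3)).sepVec
        (freeFlight (Torus.geometry (Fin 3)) (freeEntranceTime (hsDiameter σ N) (zipConfig (x, v)) i j) (zipConfig (x, v)) i).1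
        (freeFlight (Torus.geometry (Fin 3)) (freeEntranceTime (hsDiameter σ N) (zipConfig (x, v)) i j) (zipConfig (x, v)) j).1 ∈ U ∧
      (fun k => q (x k)) ∈ T} =
      ({x : Fin (N + 1) → T3 | zipConfig (x, v) ∈ firstFlightGhostEvent Ψ i j emb w ∧
        (hsDiameter σ N)⁻¹ • (Torus.geometry (Fin 3)).sepVec
          (freeFlight (Torus.geometry (Fin 3)) (freeEntranceTime (hsDiameter σ N) (zipConfig (x, v)) i j) (zipConfig (x, v)) i).1
          (freeFlight (Torus.geometry (Fin 3)) (freeEntranceTime (hsDiameter σ N) (zipConfig (x, v)) i j) (zipConfig (x, v)) j).1 ∈ U ∧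
        (fun k => q (x k)) ∈ T} ∩ posDomain (hsDiameter σ N) (N + 1)) ∩
        {x | freeEntranceTime (hsDiameter σ N) (zipConfig (x, v)) i j ∈ Set.Ioc 0 w} := by
    ext x
    simp only [Set.mem_inter_iff, Set.mem_setOf_eq, firstFlightGhostEvent]
    tauto
  rw [hsub, volume_inter_freeEntranceTime_mem_Ioc_eq hε hε4 hw v hij hg' hgw (measurable_freeEntranceTime_zip (hsDiameter σ N) v i j)
    (hSm.inter (measurableSet_posDomain (hsDiameter σ N) (N + 1)))]
  refine lintegral_congr fun ω => ?_
  refine setLIntegral_congr_fun measurableSet_Ioc fun t ht => ?_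
  have hω : ‖(ω : V3)‖ = 1 := norm_eq_of_mem_sphere ω
  by_cases hωg : inner ℝ (ω : V3) (v i - v j) ≤ 0
  · have hgt : ‖v i - v j‖ * t ≤ 4⁻¹ := (mul_le_mul_of_nonneg_left ht.2 (norm_nonneg _)).trans hgw
    rw [preimage_contactConfig_firstFlightGhostEvent Ψ hij emb v hε hε4 hg ht hgt hω hωg U q T]
    by_cases hUω : (ω : V3) ∈ U
    · rw [Set.indicator_of_mem hUω]
      have hset : {_x : Fin (N + 1) → T3 | (ω : V3) ∈ U} ∩ (twoTubeEvent Ψ i j emb v t ω ∩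
          {x | contactCells q (hsDiameter σ N) v i j t ω x ∈ T}) =
          twoTubeEvent Ψ i j emb v t ω ∩ {x | contactCells q (hsDiameter σ N) v i j t ω x ∈ T} := by
        ext x
        simp only [Set.mem_inter_iff, Set.mem_setOf_eq, hUω, true_and]
      rw [hset]
    · rw [Set.indicator_of_notMem hUω]
      have : {_x : Fin (N + 1) → T3 | (ω : V3) ∈ U} ∩ (twoTubeEvent Ψ i j emb v t ω ∩
          {x | contactCells q (hsDiameter σ N) v i j t ω x ∈ T}) = ∅ := by
        ext x
        simp only [Set.mem_inter_iff, Set.mem_setOf_eq, hUω, false_and, Set.mem_empty_iff_false]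
      rw [this, measure_empty]
  · have hwt : ENNReal.ofReal ((hsDiameter σ N) ^ 2 * max (-inner ℝ (ω : V3) (v i - v j)) 0) = 0 := by
      rw [max_eq_right (by linarith [not_le.mp hωg]), mul_zero, ENNReal.ofReal_zero]
    rw [hwt, mul_zero, mul_zero]

end FibreFormula


end

end Summit.AtomisticToContinuum.HydrodynamicLimit.Theorems.OLC

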